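import Summits.HodgeConjecture.HodgeConjecture.Theorems.Ring2AbelianAllAndreTransportLattice
import Summits.HodgeConjecture.HodgeConjecture.Theorems.Ring2AbelianAllAndreFibreClassAlgebraicFibre
import Literature.AlgebraicGeometry.HodgeTheory.MotivatedClassesHodgeClassesHolds
import HarnessLib

/-!
# Ring 2 · sub-cell AbelianAll (ALL ABELIAN VARIETIES), André axis, part XVII-f — THE HODGE-INVARIANT SUBLATTICE IS
# CONSTANT: `D_s := (j_s^*)⁻¹(Hdg^p(𝒳_s) ⊗ ℂ)` does not depend on `s` (Deligne Hodge II 4.1.2 + (4.1.3.1) in lattice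
# form), `C_s := (j_s^*)⁻¹N^p(𝒳_s) ⊆ D` always with EQUALITY at CM points under `HC_CM`; so under `HC_CM` the
# `B_min` candidate (4) on a CM-pointed pencil says exactly `C_s = D` for all `s`, and
# `HC_AV ⟺ HC_CM ∧ [C ≡ D on CM-pointed compact pencils]` (modulo André's Lemme 6.3.1)

HONEST FRAMING (page 1, verbatim): **research route, not a corollary; conditional on HC_CM plus one named
minimal statement.** Cell line: research route conditional on HC_CM; not a corollary; Q11.4-sentence-2
already refuted in dim ≥ 3. Nothing in this file proves a case of the Hodge conjecture for an abelian variety.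
`HC_CM` = `Theses.RankFourFaces.CMAbelianHodge` (stmt-HodgeConjecture-3052) is a BINDER wherever it occurs; `HC_AV` =
`Theses.PadicSemiregularLift.HodgeAbelianVarieties`; item `Theses.RankFourFaces.CMToAbelian` (stmt-16267) OPEN and not
closed here. Seat `pub-hodge-ring2-ab-andre-2`, gen 9 (sequel of parts XVII-a/b/e).

## Notation

For a compact pencil `f : 𝒳 ⟶ S` of abelian `d`-folds, a degree `p` and a point `s`:
`B_s := span_ℂ {rational (p,p)-classes of 𝒳_s} = Hdg^p(𝒳_s) ⊗ ℂ` (written inline, no definition),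
`D_s := (j_s^*)⁻¹ B_s ⊆ H²ᵖ(𝒳(ℂ); ℂ)` (the HODGE-INVARIANT classes), `C_s := (j_s^*)⁻¹ N^p(𝒳_s)` (the classes
ALGEBRAIC on `𝒳_s`, part XVII-b).

## What is proved (theorems only; no definition, no named fact, no sorry)

§1 `isOfHodgeType_of_mem_span_hodge` (the span of the rational `(p,p)`-classes consists of classes of type `(p,p)`);
**`comap_hodgeSpan_map_fiberι_le` / `_eq` — `D_s = D_t` for all `s, t`**: the Hodge-invariant sublattice does not depend
on the fibre (`D_s` is spanned by RATIONAL global classes `W'` with `j_s^*W' ∈ B_s` — part XVII-b §2 — and for rational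
`W'`, "`j_s^*W'` is a Hodge class" is independent of `s` — parts XVI-a / XVII-a). `comap_algebraicClasses_le_comap_hodgeSpan`
— `C_s ≤ D_s` (algebraic classes lie in `B_s`, the tree's `algebraicClasses_le_span_hodgeClasses`).

§2 `comap_algebraicClasses_eq_comap_hodgeSpan_of_hodgeConjectureFor` — `HC` for the fibre `𝒳_t` gives `C_t = D_t`;
**`…_of_HC_CM` — under `HC_CM`, `C_t = D_t` at every CM point `t`** (the tree's `Ring2Transport.mem_algebraicClasses_of_cmChart`).

§3 **`cmAnchoredTransport_iff_comap_eq_hodge_of_HC_CM` — `HC_CM ⊢ (4) ⟺ [on every compact pencil of abelian varieties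
with a CM fibre: `C_s = D_s` for every `s`]`** ("every Hodge-invariant class is algebraic on every fibre"; (4)'s anchor
is absorbed: `C_t = D` at the CM point and `C_s ⊆ D`). `cmPointedPencilVHC_iff_comap_eq_hodge_of_HC_CM` — the same for
(3) (so (3) ⟺ (4) under `HC_CM`, the lattice form of part I's `candidates_iff_of_HC_CM`).
**`HC_AV_iff_HC_CM_and_comap_eq_hodge`** — modulo André's Lemme 6.3.1 (`h₂₁`, binder):
`HC_AV ⟺ HC_CM ∧ [C ≡ D on CM-pointed compact pencils]`.

READING (RING2-MAP §AbelianAll gen 9). In the lattice of part XVII-b there is a fourth, CONSTANT subspace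
`D = (j_s^*)⁻¹(Hdg^p(𝒳_s) ⊗ ℂ)` (any `s`) with `N^p(𝒳) + ker j_s^* ⊆ C_s ⊆ D`. The Hodge conjecture for one fibre is
`C_t = D`; `HC_CM` supplies it at CM points; and the `B_min` of this axis — transport (4), equivalently (3) — is, granted
`HC_CM`, the statement that `s ↦ C_s` is CONSTANT (then `= D`) on CM-pointed compact pencils. EDGE LABELS: §1 K
unconditional; §2–§3 K[HC_CM] (binder), the last row also K[h₂₁]; no def, no named fact beyond the part-I binder `h₂₁`.

References: DeligneHodgeII1971 (Cor. 4.1.2, (4.1.3.1)); GrothendieckTopology1969 (§1); VoisinHodgeI2002 (§7.1.1,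
§11.3); Andre1996Motifs (Lemme 6.3.1 p. 31, §6.3 p. 33); Abdulali1994FamiliesAV ((1.1), Lemma 6.2); Deligne2000 (§1).
-/

noncomputable section

set_option linter.dupNamespace false

namespace Summit.HodgeConjecture.HodgeConjecture.Ring2.AbelianAll

open CategoryTheory AlgebraicGeometry
open Literature.AlgebraicGeometry Literature.AlgebraicGeometry.Motives
open Literature.AlgebraicGeometry.HodgeTheory
open Literature.AlgebraicGeometry.Abdulali1994 (InvariantCyclesHoldFor)
open Literature.AlgebraicGeometry.Deligne1982 (cmLocus)
open Literature.AlgebraicGeometry.Andre1996 (andre1996_cmAnchoredPencil)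
open Summit.HodgeConjecture.HodgeConjecture.Theses

variable {𝒳 S : SchemeOver ℂ}

/-! ## §1 The Hodge-invariant sublattice is constant -/

section Span

variable {n : ℕ} {X : SchemeOver ℂ}

/-- The `ℂ`-span of the rational `(p,p)`-classes of a smooth projective `X` consists of classes of type `(p,p)` (a type
piece of a Hodge model is a `ℂ`-subspace). [cite: VoisinHodgeI2002, §7.1.1 and Prop. 6.11] -/
theorem isOfHodgeType_of_mem_span_hodge (hX : IsSmoothProjective n X) (p : ℕ) {c : complexBetti X (2 * p)}
    (hc : c ∈ Submodule.span ℂ {c : complexBetti X (2 * p) | IsRationalClass c ∧ IsOfHodgeType n X (2 * p) p p c}) :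
    IsOfHodgeType n X (2 * p) p p c := by
  obtain ⟨A⟩ := nonempty_hodgeModel_holds hX
  have hpp : (p, p) ∈ Finset.HasAntidiagonal.antidiagonal (2 * p) :=
    Finset.HasAntidiagonal.mem_antidiagonal.2 (by ring)
  have hle : Submodule.span ℂ {c : complexBetti X (2 * p) | IsRationalClass c ∧ IsOfHodgeType n X (2 * p) p p c} ≤
      A.typePiece (2 * p) ⟨(p, p), hpp⟩ :=
    Submodule.span_le.2 fun c hc ↦ A.mem_typePiece_of_isOfHodgeType hodgePQ_independent_of_hodgeModel_holds hX hpp hc.2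
  have h := A.isOfHodgeType_of_mem_typePiece (hle hc)
  exact h

end Span

/-- **`D_s ≤ D_t`**: a global class whose restriction to `𝒳_s` lies in `Hdg^p(𝒳_s) ⊗ ℂ` has restriction to `𝒳_t` in
`Hdg^p(𝒳_t) ⊗ ℂ` — it is a combination of RATIONAL global classes with the same property (part XVII-b §2), and for a
rational global class "Hodge on `𝒳_s`" ⟺ "Hodge on `𝒳_t`" (parts XVI-a / XVII-a). [cite: DeligneHodgeII1971, Cor. 4.1.2 and (4.1.3.1)]
[cite: GrothendieckTopology1969, §1] -/
theorem comap_hodgeSpan_map_fiberι_le {d : ℕ} {f : 𝒳 ⟶ S} (hf : IsCompactAbelianPencil f d) (p : ℕ)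
    (s t : ComplexPoints S) :
    (Submodule.span ℂ {c : complexBetti (fiberOver f s) (2 * p) |
        IsRationalClass c ∧ IsOfHodgeType d (fiberOver f s) (2 * p) p p c}).comap
      (complexBetti.map (fiberι f s) (2 * p)).hom ≤
    (Submodule.span ℂ {c : complexBetti (fiberOver f t) (2 * p) |
        IsRationalClass c ∧ IsOfHodgeType d (fiberOver f t) (2 * p) p p c}).comap
      (complexBetti.map (fiberι f t) (2 * p)).hom := by
  intro W hW
  set Bs := Submodule.span ℂ {c : complexBetti (fiberOver f s) (2 * p) |
    IsRationalClass c ∧ IsOfHodgeType d (fiberOver f s) (2 * p) p p c} with hBs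
  have hBs_rat : Bs ≤ Submodule.span ℂ {c : complexBetti (fiberOver f s) (2 * p) | IsRationalClass c ∧ c ∈ Bs} :=
    Submodule.span_le.2 fun c hc ↦ Submodule.subset_span ⟨hc.1, Submodule.subset_span hc⟩
  have hspan := comap_complexBetti_map_le_span_isRationalClass hf.isSmoothProjective_total (fiberι f s) Bs hBs_rat
    (W := W) hW
  refine (Submodule.span_le (p := (Submodule.span ℂ {c : complexBetti (fiberOver f t) (2 * p) |
      IsRationalClass c ∧ IsOfHodgeType d (fiberOver f t) (2 * p) p p c}).comap
    (complexBetti.map (fiberι f t) (2 * p)).hom)).2 ?_ hspan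
  rintro W' ⟨hW', hW's⟩
  have hs : IsRationalClass (complexBetti.map (fiberι f s) (2 * p) W') ∧
      IsOfHodgeType d (fiberOver f s) (2 * p) p p (complexBetti.map (fiberι f s) (2 * p) W') :=
    ⟨hW'.map (AlgPoints.mapContinuous (L := ℂ) (fiberι f s)),
      isOfHodgeType_of_mem_span_hodge (hf.isSmoothProjective_fiberOver s) p hW's⟩
  exact Submodule.subset_span ((isHodgeClass_map_fiberι_iff hf W' t s).1 hs)

/-- **THE HODGE-INVARIANT SUBLATTICE IS CONSTANT: `D_s = D_t`** — `(j_s^*)⁻¹(Hdg^p(𝒳_s) ⊗ ℂ) = (j_t^*)⁻¹(Hdg^p(𝒳_t) ⊗ ℂ)`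
in `H²ᵖ(𝒳(ℂ); ℂ)` for all points `s, t` of a compact pencil of abelian varieties (Deligne, Hodge II, Cor. 4.1.2 with
(4.1.3.1), in lattice form on the carriers). [cite: DeligneHodgeII1971, Cor. 4.1.2 and (4.1.3.1)] -/
theorem comap_hodgeSpan_map_fiberι_eq {d : ℕ} {f : 𝒳 ⟶ S} (hf : IsCompactAbelianPencil f d) (p : ℕ)
    (s t : ComplexPoints S) :
    (Submodule.span ℂ {c : complexBetti (fiberOver f s) (2 * p) |
        IsRationalClass c ∧ IsOfHodgeType d (fiberOver f s) (2 * p) p p c}).comap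
      (complexBetti.map (fiberι f s) (2 * p)).hom =
    (Submodule.span ℂ {c : complexBetti (fiberOver f t) (2 * p) |
        IsRationalClass c ∧ IsOfHodgeType d (fiberOver f t) (2 * p) p p c}).comap
      (complexBetti.map (fiberι f t) (2 * p)).hom :=
  le_antisymm (comap_hodgeSpan_map_fiberι_le hf p s t) (comap_hodgeSpan_map_fiberι_le hf p t s)

/-- **`C_s ≤ D_s`**: a global class algebraic on `𝒳_s` is Hodge-invariant (`N^p ⊆ Hdg^p ⊗ ℂ`, the tree's
`algebraicClasses_le_span_hodgeClasses`). [cite: GrothendieckTopology1969, §1] [cite: VoisinHodgeI2002, §11.3] -/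
theorem comap_algebraicClasses_le_comap_hodgeSpan {d : ℕ} {f : 𝒳 ⟶ S} (hf : IsCompactAbelianPencil f d) (p : ℕ)
    (s : ComplexPoints S) :
    (algebraicClasses (fiberOver f s) p).comap (complexBetti.map (fiberι f s) (2 * p)).hom ≤
      (Submodule.span ℂ {c : complexBetti (fiberOver f s) (2 * p) |
          IsRationalClass c ∧ IsOfHodgeType d (fiberOver f s) (2 * p) p p c}).comap
        (complexBetti.map (fiberι f s) (2 * p)).hom :=
  Submodule.comap_mono (algebraicClasses_le_span_hodgeClasses (hf.isSmoothProjective_fiberOver s) p)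

/-! ## §2 Equality `C_t = D_t` at fibres satisfying the Hodge conjecture; CM fibres under `HC_CM` -/

/-- **`HC` for the fibre `𝒳_t` in degree `2p` gives `C_t = D_t`.** [cite: Deligne2000, §1] -/
theorem comap_algebraicClasses_eq_comap_hodgeSpan_of_hodge {d : ℕ} {f : 𝒳 ⟶ S} (hf : IsCompactAbelianPencil f d)
    (p : ℕ) {t : ComplexPoints S}
    (ht : ∀ c : complexBetti (fiberOver f t) (2 * p), IsRationalClass c →
      IsOfHodgeType d (fiberOver f t) (2 * p) p p c → c ∈ algebraicClasses (fiberOver f t) p) :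
    (algebraicClasses (fiberOver f t) p).comap (complexBetti.map (fiberι f t) (2 * p)).hom =
      (Submodule.span ℂ {c : complexBetti (fiberOver f t) (2 * p) |
          IsRationalClass c ∧ IsOfHodgeType d (fiberOver f t) (2 * p) p p c}).comap
        (complexBetti.map (fiberι f t) (2 * p)).hom :=
  le_antisymm (comap_algebraicClasses_le_comap_hodgeSpan hf p t)
    (Submodule.comap_mono (Submodule.span_le.2 fun c hc ↦ ht c hc.1 hc.2))

/-- **Under `HC_CM`, `C_t = D_t` at every CM point `t`** (a CM fibre is presented by a CM abelian variety, on which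
`HC_CM` makes every rational `(p,p)`-class algebraic — the tree's `Ring2Transport.mem_algebraicClasses_of_cmChart`).
`HC_CM` is a BINDER. [cite: Andre1996Motifs, §6.3 a) (p. 33)] [cite: Deligne2000, §1] -/
theorem comap_algebraicClasses_eq_comap_hodgeSpan_of_HC_CM (hCM : RankFourFaces.CMAbelianHodge) {d : ℕ}
    {f : 𝒳 ⟶ S} (hf : IsCompactAbelianPencil f d) (p : ℕ) {t : ComplexPoints S} (ht : t ∈ cmLocus f d) :
    (algebraicClasses (fiberOver f t) p).comap (complexBetti.map (fiberι f t) (2 * p)).hom =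
      (Submodule.span ℂ {c : complexBetti (fiberOver f t) (2 * p) |
          IsRationalClass c ∧ IsOfHodgeType d (fiberOver f t) (2 * p) p p c}).comap
        (complexBetti.map (fiberι f t) (2 * p)).hom := by
  obtain ⟨A₀, ⟨e₀⟩, hdim, hcm⟩ := ht
  exact comap_algebraicClasses_eq_comap_hodgeSpan_of_hodge hf p fun c hc hcpp ↦
    Ring2Transport.mem_algebraicClasses_of_cmChart hCM A₀ e₀ hdim hcm hc hcpp

/-! ## §3 Under `HC_CM` the `B_min` candidates (3), (4) say: `C_s = D` for every `s` on CM-pointed pencils -/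

/-- **`HC_CM ⊢ (4) ⟺ [on every compact pencil of abelian varieties with a CM fibre, every Hodge-invariant class is
algebraic on every fibre: `C_s = D_s` for all `s`]`.** (⟹: at a CM point `t`, `C_t = D_t = D_s ⊇ C_s ⊇ C_t` by (4);
⟸: `C_t ⊆ D_t = D_s = C_s`.) `HC_CM` is a BINDER. [cite: Andre1996Motifs, §6.3 a) (p. 33)] [cite: Abdulali1994FamiliesAV, Lemma 6.2 (p. 1131)]
[cite: DeligneHodgeII1971, Cor. 4.1.2] -/
theorem cmAnchoredTransport_iff_comap_eq_hodge_of_HC_CM (hCM : RankFourFaces.CMAbelianHodge) :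
    CMAnchoredTransport ↔ ∀ ⦃d : ℕ⦄ ⦃𝒳 S : SchemeOver ℂ⦄ (f : 𝒳 ⟶ S) (hf : IsCompactAbelianPencil f d),
      (cmLocus f d).Nonempty → ∀ (p : ℕ) (s : ComplexPoints S),
        (algebraicClasses (fiberOver f s) p).comap (complexBetti.map (fiberι f s) (2 * p)).hom =
          (Submodule.span ℂ {c : complexBetti (fiberOver f s) (2 * p) |
              IsRationalClass c ∧ IsOfHodgeType d (fiberOver f s) (2 * p) p p c}).comap
            (complexBetti.map (fiberι f s) (2 * p)).hom := by
  rw [cmAnchoredTransport_iff_comap]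
  refine ⟨fun h d 𝒳 S f hf hne p s ↦ ?_, fun h d 𝒳 S f hf p t ht s ↦ ?_⟩
  · obtain ⟨t, ht⟩ := hne
    refine le_antisymm (comap_algebraicClasses_le_comap_hodgeSpan hf p s) ?_
    rw [← comap_hodgeSpan_map_fiberι_eq hf p t s, ← comap_algebraicClasses_eq_comap_hodgeSpan_of_HC_CM hCM hf p ht]
    exact h f hf p t ht s
  · rw [h f hf ⟨t, ht⟩ p s, ← comap_hodgeSpan_map_fiberι_eq hf p t s]
    exact comap_algebraicClasses_le_comap_hodgeSpan hf p t

/-- **`HC_CM ⊢ (3) ⟺ the same statement** (so (3) ⟺ (4) under `HC_CM`: the lattice form of part I's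
`candidates_iff_of_HC_CM`). `HC_CM` is a BINDER. [cite: Andre1996Motifs, Lemme 6.3.1 (p. 31) and Remarque 2 (p. 33)]
[cite: Abdulali1994FamiliesAV, (1.1) (p. 1122)] -/
theorem cmPointedPencilVHC_iff_comap_eq_hodge_of_HC_CM (hCM : RankFourFaces.CMAbelianHodge) :
    CMPointedPencilVHC ↔ ∀ ⦃d : ℕ⦄ ⦃𝒳 S : SchemeOver ℂ⦄ (f : 𝒳 ⟶ S) (hf : IsCompactAbelianPencil f d),
      (cmLocus f d).Nonempty → ∀ (p : ℕ) (s : ComplexPoints S),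
        (algebraicClasses (fiberOver f s) p).comap (complexBetti.map (fiberι f s) (2 * p)).hom =
          (Submodule.span ℂ {c : complexBetti (fiberOver f s) (2 * p) |
              IsRationalClass c ∧ IsOfHodgeType d (fiberOver f s) (2 * p) p p c}).comap
            (complexBetti.map (fiberι f s) (2 * p)).hom := by
  refine ⟨fun h ↦ (cmAnchoredTransport_iff_comap_eq_hodge_of_HC_CM hCM).1 (cmAnchoredTransport_of_cmPointedPencilVHC h),
    fun h d 𝒳 S f hf hne ↦ ?_⟩
  rw [invariantCyclesHoldFor_iff_comap_eq hf]
  intro p s s'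
  rw [h f hf hne p s, h f hf hne p s', comap_hodgeSpan_map_fiberι_eq hf p s s']

/-- **`HC_AV ⟺ HC_CM ∧ [C ≡ D on CM-pointed compact pencils]`**, modulo André's Lemme 6.3.1 (`h₂₁`, a binder): the
Hodge conjecture for all abelian varieties is `HC_CM` plus "on every compact pencil of abelian varieties with a CM fibre,
the classes of the total space algebraic on `𝒳_s` are exactly the Hodge-invariant ones, for every `s`" (part I's
exactness `HC_AV ⟺ HC_CM ∧ (4)` with §3). [cite: Andre1996Motifs, Lemme 6.3.1 (p. 31) and §6.3 a) (p. 33)] -/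
theorem HC_AV_iff_HC_CM_and_comap_eq_hodge (h₂₁ : andre1996_cmAnchoredPencil) :
    PadicSemiregularLift.HodgeAbelianVarieties ↔ RankFourFaces.CMAbelianHodge ∧
      ∀ ⦃d : ℕ⦄ ⦃𝒳 S : SchemeOver ℂ⦄ (f : 𝒳 ⟶ S) (hf : IsCompactAbelianPencil f d),
        (cmLocus f d).Nonempty → ∀ (p : ℕ) (s : ComplexPoints S),
          (algebraicClasses (fiberOver f s) p).comap (complexBetti.map (fiberι f s) (2 * p)).hom =
            (Submodule.span ℂ {c : complexBetti (fiberOver f s) (2 * p) |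
                IsRationalClass c ∧ IsOfHodgeType d (fiberOver f s) (2 * p) p p c}).comap
              (complexBetti.map (fiberι f s) (2 * p)).hom := by
  rw [HC_AV_iff_HC_CM_and_cmAnchoredTransport h₂₁]
  exact ⟨fun ⟨hCM, h4⟩ ↦ ⟨hCM, (cmAnchoredTransport_iff_comap_eq_hodge_of_HC_CM hCM).1 h4⟩,
    fun ⟨hCM, h⟩ ↦ ⟨hCM, (cmAnchoredTransport_iff_comap_eq_hodge_of_HC_CM hCM).2 h⟩⟩

end Summit.HodgeConjecture.HodgeConjecture.Ring2.AbelianAll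

end
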